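import Summits.QuantumFields.YangMills.Theorems.HyperbolicRegulatorHyperbolicToTorus

/-!
# `CurvatureUniformity` (stmt-QuantumFields-15825) — Negative: the hypotheses of the crux AS TYPED are jointly unsatisfiable

Refuter (cdisprove) negative lemma for the crux `Summit.QuantumFields.YangMills.Theses.HyperbolicRegulator.CurvatureUniformity`
(`∀ G r family, H_adm → H_anchor → T`).  Its admissibility hypothesis `H_adm := ∀ k j, 8 ≤ k → Adm k j …` (`Adm` = the crux's
inlined `(Fam …).1`, named in `Theorems/HyperbolicRegulatorHyperbolicToTorusDefs.lean`) is contradictory for EVERY choice of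
family data, by the tree's `NoAdmissibleComplex.no_admissible` (no admissible complex at curvature scale `k ≥ 208`: flat
threshold `k/4` = chart sup-radius `k/4`).  So the crux holds with ANY conclusion (it was closed `proved` vacuously by
`CurvatureUniformity_of_no_admissible`), `¬ CurvatureUniformity` can never land for this typing, and the only load-bearing
hypothesis is `H_adm` at ONE scale — the group, the representation, the anchor hypothesis and `β` are idle.  Informative content
for the pending lockstep restate of 15825/15826/15827: `Cruxes/CurvatureUniformity/Disproof.lean` (pre-restate audit of the
repaired clauses R-a/R-b/R-c, exposures E1–E4).
-/

set_option autoImplicit false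

namespace Summit.QuantumFields.YangMills.Theorems.CurvatureUniformity.Negative

open Summit.QuantumFields.YangMills.Cruxes.HyperbolicToTorus.NoAdmissibleComplex

/-- **The hypotheses of `CurvatureUniformity` (as typed, route rev 2) are jointly unsatisfiable**: admissibility of the family
at all curvature scales `k ≥ 8` is contradictory for every data `(V, E, Q, σ, τ, bd, cV, cE)` — instantiate at `k = 208`,
`j = 0` and apply `NoAdmissibleComplex.no_admissible`.  (Vacuity certificate; any proof of the typed crux "must use" only this.) -/
theorem curvatureUniformity_hypotheses_unsat
    (V E Q : ℕ → ℕ → Finset ℕ) (σ τ : ℕ → ℕ → ℕ → ℕ) (bd : ℕ → ℕ → ℕ → Fin 4 → ℕ × Bool)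
    (cV : ℕ → ℕ → ℕ → ℤ × ℤ → ℕ) (cE : ℕ → ℕ → ℕ → ℤ × ℤ → Fin 2 → ℕ × Bool)
    (hAdm : ∀ k j, 8 ≤ k → Adm k j (V k j) (E k j) (Q k j) (σ k j) (τ k j) (bd k j) (cV k j) (cE k j)) :
    False :=
  no_admissible 208 0 _ _ _ _ _ _ _ _ le_rfl (hAdm 208 0 (by norm_num))

/-- **Admissibility fails at every single scale `k₀ ≥ 208`** (the `∀ k ≥ 8` of `H_adm` is consumed at one instance). -/
theorem curvatureUniformity_adm_unsat_at {k₀ : ℕ} (hk₀ : 208 ≤ k₀) (j₀ : ℕ)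
    (V E Q : Finset ℕ) (σ τ : ℕ → ℕ) (bd : ℕ → Fin 4 → ℕ × Bool) (cV : ℕ → ℤ × ℤ → ℕ)
    (cE : ℕ → ℤ × ℤ → Fin 2 → ℕ × Bool) : ¬ Adm k₀ j₀ V E Q σ τ bd cV cE :=
  no_admissible k₀ j₀ V E Q σ τ bd cV cE hk₀

end Summit.QuantumFields.YangMills.Theorems.CurvatureUniformity.Negative
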